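import Mathlib
import Literature.NumberTheory.Automorphic.HilbertModularFormQExpansion
import Summits.Langlands.Langlands.Theorems.CapacityClassicalityHilbertIntegralOverconvergentIsCongruenceStubFourierCoeffMul
import Summits.Langlands.Langlands.Theorems.CapacityClassicalityHilbertIntegralOverconvergentIsCongruenceStubFiniteQIndexAntidiagonal
import Summits.Langlands.Langlands.Theorems.CapacityClassicalityHilbertIntegralOverconvergentIsCongruenceStubEncodedMul
import Summits.Langlands.Langlands.Theorems.CapacityClassicalityHilbertIntegralOverconvergentIsCongruenceKoecherPrinciple

/-!
# The theta seed, I: natural-number Fourier coefficients (line Sketch-ideate-r1-k1, § V, stub V8)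

Lead's helpers for the composition stub `stub_thetaSeed` of line Sketch-ideate-r1-k1 of the crux
`HilbertIntegralOverconvergentIsCongruence` (stmt-Langlands-8485).  Section V shows that `Θ⁴`,
`Θ(z) = ∑_{x ∈ 𝓞F} e^{2πi S(x² z)}`, is a non-constant Hilbert modular form of parallel weight `2`
with integer coefficients.  This file is the COEFFICIENT side, stated for general functions:

* `ts_fourierCoeffAt_congr`: Fourier coefficients only see the values on `ℍ`;
* `ts_natCoeff_of_qSeries`: a function that agrees on `ℍ` with an absolutely convergent `q`-series
  `∑_{ν ∈ 𝔡⁻¹} a_ν e^{2πi S(νz)}` with coefficients `a_ν ∈ ℕ` is holomorphic on `ℍ`, `𝓞F`-periodic on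
  `ℍ`, and has Fourier coefficients `a_ν` (the landed `qSeriesPackage`);
* `ts_natCoeff_mul`: if `f`, `g` are holomorphic, `𝓞F`-periodic, with `ℕ`-valued Fourier
  coefficients `a`, `b` on the dual lattice supported on the cone `qIndexSet F`, then `fg` has
  `ℕ`-valued coefficients `c` supported on the cone with `c(μ₁ + μ₂) ≥ a(μ₁) b(μ₂)` for cone indices
  `μ₁, μ₂` (the landed product formula `stub_fourierCoeff_mul`: `c(ν) = ∑_{μ₁+μ₂=ν} a(μ₁) b(μ₂)` over
  the finitely many cone pairs, `stub_finite_qIndex_antidiagonal`).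

Applied to `Θ` (coefficients `r(ν) = #{x : x² = ν}`, `r(0) = 1`, `r(1) = 2`) twice, this gives the
integrality of the coefficients of `Θ⁴` and `a₁(Θ⁴) ≥ a₀(Θ²) a₁(Θ²) ≥ r(0)² · r(0) r(1) = 2 ≠ 0`.
-/

set_option linter.dupNamespace false

noncomputable section

namespace Summit.Langlands.Langlands.Theorems.HilbertIntegralOverconvergentIsCongruence

open MeasureTheory Complex NumberField
open Literature.NumberTheory.Automorphic Literature.NumberTheory.Automorphic.HilbertModular
open scoped MatrixGroups

/-- Fourier coefficients at a height `y ≫ 0` only see the values of the function on `ℍ` (the cube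
points `x + iy` lie in `ℍ`). [folklore] -/
theorem ts_fourierCoeffAt_congr {F : Type} [Field F] [NumberField F] {f g : Point F → ℂ}
    (h : ∀ z ∈ halfSpace F, f z = g z) (ν : F) {y : (F →+* ℝ) → ℝ} (hy : ∀ σ, 0 < y σ) :
    fourierCoeffAt f ν y = fourierCoeffAt g ν y := by
  simp only [fourierCoeffAt]
  refine setIntegral_congr_fun measurableSet_Icc fun x _ ↦ ?_
  rw [h _ (koe_cubePoint_mem_halfSpace x hy)]

/-- Fourier coefficients (at the standard height) only see the values on `ℍ`. [folklore] -/
theorem ts_fourierCoeff_congr {F : Type} [Field F] [NumberField F] {f g : Point F → ℂ}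
    (h : ∀ z ∈ halfSpace F, f z = g z) (ν : F) : fourierCoeff f ν = fourierCoeff g ν :=
  ts_fourierCoeffAt_congr h ν fun _ ↦ one_pos

/-- Holomorphy on `ℍ` only sees the values on the open set `ℍ`. [folklore] -/
theorem ts_isHolomorphicOn_congr {F : Type} [Field F] [NumberField F] {f g : Point F → ℂ}
    (h : ∀ z ∈ halfSpace F, f z = g z) (hg : IsHolomorphicOn F g) : IsHolomorphicOn F f :=
  hg.congr h

/-- **`ℕ`-valued `q`-series.** A function `f` that agrees on `ℍ` with an absolutely convergent
`q`-series `∑_{ν ∈ 𝔡⁻¹} a_ν e^{2πi S(νz)}`, `a_ν ∈ ℕ`, is holomorphic on `ℍ`, `𝓞F`-periodic on `ℍ`, and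
its Fourier coefficients on the dual lattice are the `a_ν` (landed `qSeriesPackage`). [folklore] -/
theorem ts_natCoeff_of_qSeries (F : Type) [Field F] [NumberField F] [NumberField.IsTotallyReal F]
    (a : F → ℕ) (f : Point F → ℂ)
    (habs : ∀ y : (F →+* ℝ) → ℝ, (∀ σ, 0 < y σ) →
      Summable (fun ν : {ν : F | ∀ b : 𝓞 F, ∃ n : ℤ, Algebra.trace ℚ F (ν * b) = n} ↦
        ‖((a ν : ℕ) : ℂ)‖ * Real.exp (-(2 * Real.pi * ∑ σ : F →+* ℝ, σ (ν : F) * y σ))))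
    (hf : ∀ z ∈ halfSpace F, f z =
      ∑' ν : {ν : F | ∀ b : 𝓞 F, ∃ n : ℤ, Algebra.trace ℚ F (ν * b) = n},
        ((a ν : ℕ) : ℂ) * cexp (2 * Real.pi * I * pairing (ν : F) z)) :
    IsHolomorphicOn F f ∧
    (∀ (b : 𝓞 F) (z : Point F), z ∈ halfSpace F → f (fun σ ↦ z σ + ((σ (b : F) : ℝ) : ℂ)) = f z) ∧
    ∀ μ : F, (∀ b : 𝓞 F, ∃ n : ℤ, Algebra.trace ℚ F (μ * b) = n) → fourierCoeff f μ = (a μ : ℂ) := by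
  obtain ⟨hhol, hper, hcoeff⟩ := qSeriesPackage F (fun ν ↦ ((a ν : ℕ) : ℂ)) habs
  refine ⟨ts_isHolomorphicOn_congr hf hhol, fun b z hz ↦ ?_, fun μ hμ ↦ ?_⟩
  · have hzb : (fun σ ↦ z σ + ((σ (b : F) : ℝ) : ℂ)) ∈ halfSpace F := fun σ ↦ by
      simpa using hz σ
    rw [hf _ hzb, hf _ hz]
    exact hper b z hz
  · rw [fourierCoeff_eq, ts_fourierCoeffAt_congr hf μ fun _ ↦ one_pos]
    exact hcoeff μ hμ _ fun _ ↦ one_pos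

/-- **Products of functions with `ℕ`-valued coefficients.** If `f`, `g` are holomorphic and
`𝓞F`-periodic on `ℍ` with `ℕ`-valued Fourier coefficients `a`, `b` on the dual lattice `𝔡⁻¹`, both
supported on the cone `qIndexSet F`, then `fg` has `ℕ`-valued coefficients `c` on `𝔡⁻¹`, supported on the
cone, with `a(μ₁) b(μ₂) ≤ c(μ₁ + μ₂)` for cone indices `μ₁, μ₂` (`c(ν) = ∑_{μ₁ + μ₂ = ν} a(μ₁) b(μ₂)` over
the finitely many cone pairs, landed `stub_fourierCoeff_mul` and `stub_finite_qIndex_antidiagonal`). [folklore] -/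
theorem ts_natCoeff_mul (F : Type) [Field F] [NumberField F] [NumberField.IsTotallyReal F]
    (f g : Point F → ℂ) (hf : IsHolomorphicOn F f) (hg : IsHolomorphicOn F g)
    (hperf : ∀ (b : 𝓞 F) (z : Point F), z ∈ halfSpace F → f (fun σ ↦ z σ + ((σ (b : F) : ℝ) : ℂ)) = f z)
    (hperg : ∀ (b : 𝓞 F) (z : Point F), z ∈ halfSpace F → g (fun σ ↦ z σ + ((σ (b : F) : ℝ) : ℂ)) = g z)
    (a b : F → ℕ)
    (hfa : ∀ μ : F, (∀ b : 𝓞 F, ∃ n : ℤ, Algebra.trace ℚ F (μ * b) = n) → fourierCoeff f μ = (a μ : ℂ))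
    (ha : ∀ μ : F, (∀ b : 𝓞 F, ∃ n : ℤ, Algebra.trace ℚ F (μ * b) = n) → μ ∉ qIndexSet F → a μ = 0)
    (hgb : ∀ μ : F, (∀ b : 𝓞 F, ∃ n : ℤ, Algebra.trace ℚ F (μ * b) = n) → fourierCoeff g μ = (b μ : ℂ))
    (hb : ∀ μ : F, (∀ b : 𝓞 F, ∃ n : ℤ, Algebra.trace ℚ F (μ * b) = n) → μ ∉ qIndexSet F → b μ = 0) :
    ∃ c : F → ℕ,
      (∀ ν : F, (∀ b : 𝓞 F, ∃ n : ℤ, Algebra.trace ℚ F (ν * b) = n) →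
        fourierCoeff (f * g) ν = (c ν : ℂ)) ∧
      (∀ ν : F, (∀ b : 𝓞 F, ∃ n : ℤ, Algebra.trace ℚ F (ν * b) = n) → ν ∉ qIndexSet F → c ν = 0) ∧
      ∀ μ₁ ∈ qIndexSet F, ∀ μ₂ ∈ qIndexSet F, a μ₁ * b μ₂ ≤ c (μ₁ + μ₂) := by
  classical
  have hT : ∀ ν : F, ∃ T : Finset (F × F),
      ∀ μ : F × F, μ ∈ T ↔ μ.1 ∈ qIndexSet F ∧ μ.2 ∈ qIndexSet F ∧ μ.1 + μ.2 = ν := fun ν ↦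
    ⟨(stub_finite_qIndex_antidiagonal F ν).toFinset, fun μ ↦ by
      rw [Set.Finite.mem_toFinset]; rfl⟩
  choose T hT using hT
  have hsf : ∀ μ : F, (∀ b : 𝓞 F, ∃ n : ℤ, Algebra.trace ℚ F (μ * b) = n) → μ ∉ qIndexSet F →
      fourierCoeff f μ = 0 := fun μ hμ hμc ↦ by
    rw [hfa μ hμ, ha μ hμ hμc, Nat.cast_zero]
  have hsg : ∀ μ : F, (∀ b : 𝓞 F, ∃ n : ℤ, Algebra.trace ℚ F (μ * b) = n) → μ ∉ qIndexSet F →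
      fourierCoeff g μ = 0 := fun μ hμ hμc ↦ by
    rw [hgb μ hμ, hb μ hμ hμc, Nat.cast_zero]
  refine ⟨fun ν ↦ ∑ μ ∈ T ν, a μ.1 * b μ.2, fun ν hν ↦ ?_, fun ν _ hνc ↦ ?_, fun μ₁ hμ₁ μ₂ hμ₂ ↦ ?_⟩
  · rw [stub_fourierCoeff_mul F f g hf hg hperf hperg hsf hsg ν hν (T ν) (hT ν)]
    push_cast
    refine Finset.sum_congr rfl fun μ hμ ↦ ?_
    obtain ⟨h1, h2, -⟩ := (hT ν μ).1 hμ
    rw [hfa μ.1 h1.1, hgb μ.2 h2.1]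
  · refine Finset.sum_eq_zero fun μ hμ ↦ ?_
    obtain ⟨h1, h2, h3⟩ := (hT ν μ).1 hμ
    exact absurd (h3 ▸ emu_add_mem_qIndexSet h1 h2) hνc
  · have hmem : (μ₁, μ₂) ∈ T (μ₁ + μ₂) := (hT _ _).2 ⟨hμ₁, hμ₂, rfl⟩
    exact Finset.single_le_sum (f := fun μ : F × F ↦ a μ.1 * b μ.2) (fun _ _ ↦ Nat.zero_le _) hmem

end Summit.Langlands.Langlands.Theorems.HilbertIntegralOverconvergentIsCongruence
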